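import Mathlib
import HarnessLib
import Summits.HubbardSuperconductivity.HubbardSuperconductivity.Theorems.KLProgrammeKLRegimeSplitTwoLegCoreTExplicit
import Summits.HubbardSuperconductivity.HubbardSuperconductivity.Theorems.KLProgrammeKLRegimeSplitCutoffNumeralsTier1
import Summits.HubbardSuperconductivity.HubbardSuperconductivity.Theorems.KLProgrammeKLRegimeEngineV8DefsQ5

/-!
# Route `KLProgramme` — gen-5 ENGINE child 19918, stub `stub_twoLeg_step`: the slot core `TwoLegCoreT` at the RE-REGISTERED package
# `klEngQ5` (skeleton 26ce2d93b9f90451), cutoff numeral baked in (`X := 1110`)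

Cell `gate-hubbard-kl`, seat p1b (g7).  `twoLegCoreT_succ_of_position_exports_stub` (`…TwoLegCoreTExplicit`, p493178) is keyed to `klEngQ3`; the skeleton of
record since 03:58Z reads `klEngQ5 P R` (p1 g8, plan g13 (R2)).  The `_explicit` assembly is package-generic, so the twin is one term; at the same
time the non-model binder `hX : ∀ l ≤ 2, ‖Dˡχ₂‖ ≤ X` is DISCHARGED by `norm_iteratedFDeriv_salmhoferCutoff_le_of_le_two` (`X := 1110`,
`…CutoffNumeralsTier1`), so the fit `hfitS` is now a closed numeral inequality in the model's moments:

* **`twoLegCoreT_succ_of_position_exports_stub5`** — in `stub_twoLeg_step`'s literal binders (`R.WF2`, `c ≤ klEngC₃3 P R`, `U ≤ klEngU₀3 P R c`,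
  `G := klEngGeo3`, `Q := klEngQ5 P R`): `TwoLegCoreT L M hist klEngGeo3 P (klEngQ5 P R) R β U μ K (n+1)` from the position-space exports
  (increment moments `Mˢ_{k ≤ 4}`, fit into `twoLegBar … j (n+1)` with `X = 1110`; frame-Lipschitz modulus `ρ_fr` + fit into `lipBar … (n+1)`;
  `Mˢ₁, Mᵗ` of `W^{(n+1)}` + the two (E3d/e) fits).

No scale-`0` twin is given here on purpose: the scale-`0` closer's fit needs the K-separated export shape (seat p1b g7, STATUS 2026-08-27T04:27:57Z;
file `…TwoLegScaleZeroSizesSep`).  Proof only; nothing about the model is asserted.  References: BGM 2006 §2.4 (2.36) [cite: BenfattoGiulianiMastropietro2006].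
-/

noncomputable section

namespace Summit.HubbardSuperconductivity.HubbardSuperconductivity.Theorems.KLRegimeSplit

set_option linter.dupNamespace false -- summit = problem name (single-conjunct summit), D-0017

open Real Finset
open Literature.MathematicalPhysics.QuantumLattice Literature.MathematicalPhysics.QuantumLattice.BandSectorCounting
open Literature.Probability.LatticeModels
open Summit.HubbardSuperconductivity.HubbardSuperconductivity.Theorems.DispersionFlow
open Summit.HubbardSuperconductivity.HubbardSuperconductivity.Theorems.PerturbedFermiCurve
open Summit.HubbardSuperconductivity.HubbardSuperconductivity.Theorems.KLProgrammeLegKernels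
open Summit.HubbardSuperconductivity.HubbardSuperconductivity.Theorems.TwoLegFourier
open Summit.HubbardSuperconductivity.HubbardSuperconductivity.Theorems.EngineV8

variable {L M : ℕ} [NeZero L] [NeZero M]

/-- **Stub-keyed at `klEngQ5`, numeral cutoff** (`stub_twoLeg_step`'s binders, skeleton 26ce2d93b9f90451):
`TwoLegCoreT hist klEngGeo3 P (klEngQ5 P R) R β U μ K (n+1)` from the position-space exports of `twoLegCoreT_succ_of_position_exports_explicit`,
with `X := 1110`. -/
theorem twoLegCoreT_succ_of_position_exports_stub5 (P : SplitConsts) {R : RenConsts} (hRW : R.WF2) {c : ℝ} (hc : 0 < c)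
    (hcle : c ≤ klEngC₃3 P R) {U : ℝ} (hU : 0 < U) (hUle : U ≤ klEngU₀3 P R c) {β : ℝ} (hβmin : klBetaMin ≤ β)
    (hβc : β ≤ Real.exp (c / U ^ 2)) {μ : ℝ} (hμ : μ ∈ klWindowC) {K : TrigPolyC4v} (hK : FrameOK R U (nScales β) μ K)
    (hist : TrigPolyC4v → ℕ → Prop) (n : ℕ)
    -- (E3a-T1) exports
    {Ms : ℕ → ℝ}
    (hMs : ∀ k ≤ 4, ∀ (σ : Fin 2) (x₀ : SpaceTimeIdx L M), imagTimeWeight β M *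
      ∑ x ∈ (univ : Finset (Fin 2 → SpaceTimeIdx L M)).filter (fun x => x 0 = x₀),
        (1 + ((((x 1).2 - (x 0).2) 0).valMinAbs.natAbs : ℝ) + ((((x 1).2 - (x 0).2) 1).valMinAbs.natAbs : ℝ)) ^ k *
          ‖sectorisedKernel L M β (trivialMultiplier L M) (klEffectiveAction L M β U μ K klE0 (n + 1)) 2
              (![((0, σ), 0), ((0, σ), 1)] : Fin 2 → SectorLeg 1) x -
            sectorisedKernel L M β (trivialMultiplier L M) (klEffectiveAction L M β U μ K klE0 n) 2
              (![((0, σ), 0), ((0, σ), 1)] : Fin 2 → SectorLeg 1) x‖ ≤ Ms k)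
    (hfitS : ∀ j ≤ 2, (if j = 0 then 2 * Ms 0 else 0) +
      (j.factorial : ℝ) ^ 2 * (2 * j.factorial * 1110 * 200 ^ j) *
        (if j = 0 then 2 * (2 * Ms 0) else (2 * π + 1) * (2 * Ms 1 * klCurveD1) +
          (if j = 2 then 2 * Ms 2 * klCurveD1 ^ 2 + 2 * Ms 1 * klCurveD2 else 0)) *
        (4 + max 1 (((j - 1).factorial : ℝ) / (8 / 5))) ^ j ≤ twoLegBar klEngGeo3 (klEngQ5 P R) U j (n + 1))
    -- (E3c-T) export: the pinned L¹ frame-Lipschitz modulus of the increment kernel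
    {ρfr : ℝ}
    (hρ : ∀ K' : TrigPolyC4v, FrameOK R U (klTempScaleIdx β klE0) μ K' → (∀ j < n + 1, hist K' j) →
      ∀ (σ : Fin 2) (x₀ : SpaceTimeIdx L M), imagTimeWeight β M *
        ∑ x ∈ (univ : Finset (Fin 2 → SpaceTimeIdx L M)).filter (fun x => x 0 = x₀),
          (1 + ((((x 1).2 - (x 0).2) 0).valMinAbs.natAbs : ℝ) + ((((x 1).2 - (x 0).2) 1).valMinAbs.natAbs : ℝ)) ^ 0 *
            ‖sectorisedKernel L M β (trivialMultiplier L M)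
                ((klEffectiveAction L M β U μ K klE0 (n + 1) - klEffectiveAction L M β U μ K klE0 n) -
                  (klEffectiveAction L M β U μ K' klE0 (n + 1) - klEffectiveAction L M β U μ K' klE0 n)) 2
                (![((0, σ), 0), ((0, σ), 1)] : Fin 2 → SectorLeg 1) x‖ ≤ ρfr * frameDist K K')
    (hfitL : 2 * ρfr + 2 * Ms 1 / klCurveD ≤ lipBar klEngGeo3 (klEngQ5 P R) U (n + 1))
    -- (E3d/e) exports at scale `n + 1`
    {Ms₁ Mt : ℝ} (hMs₁0 : 0 ≤ Ms₁)
    (hMs₁ : ∀ (σ : Fin 2) (x₀ : SpaceTimeIdx L M), imagTimeWeight β M *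
      ∑ x ∈ (univ : Finset (Fin 2 → SpaceTimeIdx L M)).filter (fun x => x 0 = x₀),
        (1 + ((((x 1).2 - (x 0).2) 0).valMinAbs.natAbs : ℝ) + ((((x 1).2 - (x 0).2) 1).valMinAbs.natAbs : ℝ)) ^ 1 *
          ‖sectorisedKernel L M β (trivialMultiplier L M) (klEffectiveAction L M β U μ K klE0 (n + 1)) 2
            (![((0, σ), 0), ((0, σ), 1)] : Fin 2 → SectorLeg 1) x‖ ≤ Ms₁)
    (hMt : ∀ (σ : Fin 2) (x₀ : SpaceTimeIdx L M), imagTimeWeight β M *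
      ∑ x ∈ (univ : Finset (Fin 2 → SpaceTimeIdx L M)).filter (fun x => x 0 = x₀),
        imagTimeWeight β M * (circDist (2 * M) (x 0).1.val (x 1).1.val : ℝ) *
          ‖sectorisedKernel L M β (trivialMultiplier L M) (klEffectiveAction L M β U μ K klE0 (n + 1)) 2
            (![((0, σ), 0), ((0, σ), 1)] : Fin 2 → SectorLeg 1) x‖ ≤ Mt)
    (hfit1 : 2 * Ms₁ ≤ R.cz * |U| * (cDtmin (-1.2) (-0.05) / 2)) (hfit2 : 2 * Mt ≤ R.cz * |U|) :
    TwoLegCoreT L M hist klEngGeo3 P (klEngQ5 P R) R β U μ K (n + 1) :=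
  have hR : ∀ j, 0 ≤ R.Gfr j := hRW.1.2.2
  twoLegCoreT_succ_of_position_exports_explicit (L := L) (M := M) hR hc (hcle.trans (klEngC₃3_le_klCurveC3 P hR)) hU
    (hUle.trans (klEngU₀3_le_klCurveU0 P hR c)) hβmin hβc hμ hK hist klEngGeo3 P (klEngQ5 P R) n hMs
    (fun _ hl x => norm_iteratedFDeriv_salmhoferCutoff_le_of_le_two hl x) hfitS hρ hfitL hMs₁0 hMs₁ hMt hfit1 hfit2

end Summit.HubbardSuperconductivity.HubbardSuperconductivity.Theorems.KLRegimeSplit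

end
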